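import Literature.MathematicalPhysics.QuantumFieldTheory.BalabanImbrieJaffe1984to88.BIJ88TwoSpeciesPolymerGas
import Literature.MathematicalPhysics.QuantumFieldTheory.BalabanImbrieJaffe1984to88.BIJ88RootedUrsell310

/-!
# `BalabanImbrieJaffe1984to88.BIJ88VirtualSupports310` — T. Bałaban, J. Imbrie, A. Jaffe, *Effective action and cluster properties of the
abelian Higgs model*, Commun. Math. Phys. **114** (1988) 257–315 [BalabanImbrieJaffe1988], §5.14 pp. 309–310 [PDF 53–54] with §5.13 (5.13.4)
p. 306: **a pair incompatibility IS an overlap relation (virtual supports)** — the device by which the scheme of p. 310, verbatim *"We insert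
factors u(X,Y) = 0 if X, Y overlap, 1 if X, Y do not overlap, and similarly factors u(X₁,X₂), u(Y₁,Y₂). … We put u = 1 + a and expand in the
usual manner. This enables us to factor out the normalization z_t(Λ₁₂^{(k)})"*, stated for clusters with the OVERLAP hard core, applies verbatim
to the typed polymer gas of the honest two-species bookkeeping (`BIJ88TwoSpeciesPolymerGas`: incompatibility `tinc` = overlapping supports OR
both of species B and abutting).

statement-level skeleton of published theorems with citation tags; proofs where landed; nothing here is a claim about the Yang–Mills mass gap

PDF held: `paper:balaban1988-cmp114-bij-abelian-higgs-effective-action` (journal page = PDF page + 256); p. 310 = PDF 54 (read by this seat in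
gen 6 as the image `renders/original-p054-x2.png`; text `p0054.txt`).

**The print (verbatim, p. 309–310 [PDF 53–54]).** *"Next we reorganize this expansion in order to extract the truncated expectation values
(5.14.2). This involves adding and subtracting terms in a scheme familiar to one in [10]. We insert factors u(X,Y) = 0 if X, Y overlap, 1 if X,
Y do not overlap, and similarly factors u(X₁,X₂), u(Y₁,Y₂). We extend the sums over {X_γ}, {Y_δ} to nonoverlapping sets … We put u = 1 + a and
expand in the usual manner. This enables us to factor out the normalization z_t(Λ₁₂^{(k)}) … Here ℒ denotes pairs of clusters (lines) and G
runs over graphs of such lines …"*.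

WHAT IS REPRODUCED (unit `lit-balaban-p25`, generation 9 of the Phase-2 proof seat p25; SKELETON rows `C2.Claim@310` × `C2.Eq5.13.3-5.13.4`;
HOME `run/shared/lean/pub/lit-balaban/lit-balaban-p25/`). Gen 6 of this seat DERIVED the three displays of p. 310
(`BIJ88ConnectedGraphResummation`, engine `BIJ88RootedUrsell310`) for clusters `Z_i : Finset V` on a finite cube set `V` with the hard core
`𝟙[the Z_i pairwise disjoint]` (`BIJ88RootedUrsell310.hardCore`) and [Dimock2013]'s overlap Ursell coefficients `ρ^T`
(`UrsellTreeGraphBound.rhoT`, overlap graph `UrsellTreeGraphBound.overlapGraph`). Gen 9 found that the honest resummed expansion is a gas of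
TYPED polymers whose incompatibility `tinc` is finer than overlap. THIS FILE (pure finite combinatorics, any types):
* §1 for polymers `p : P` with supports `supp p : Finset C`, a finite family `Λ`, and an incompatibility `inc` (reflexive, symmetric, implied
  by overlapping supports), the VIRTUAL SUPPORT `vsupp p : Finset (C ⊕ (P × P))` = the cubes of `supp p` together with the incompatible pairs
  through `p` (both orientations, and `(p,p)`); `inl_mem_vsupp_iff` (the cube content is unchanged, so covering conditions such as *"Each X_γ
  must cover … the t-derivatives specified by H_γ"* read the same), `vsupp_injective`, and **`not_disjoint_vsupp_iff`: two virtual supports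
  OVERLAP iff the polymers are INCOMPATIBLE**;
* §2 consequences: `isCompatible_image_vsupp_iff` (compatible families = families with pairwise disjoint virtual supports),
  `polymerPartitionFunction_image_vsupp` (the partition function for `inc` IS the overlap-hard-core partition function of the virtual
  supports), `overlapGraph_vsupp_iff` / `rhoT_vsupp` (Dimock's overlap `ρ^T` of the virtual supports is the Ursell coefficient `hcUrsell` of
  `inc`), `hardCore_vsupp` (gen 6's hard core of the virtual supports is `𝟙[pairwise inc-compatible]`);
* §3 the typed gas of (5.13.4): `tvsupp adj Λ := vsupp (tinc adj) Prod.fst Λ`, with `not_disjoint_tvsupp_iff`, `inl_mem_tvsupp_iff`,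
  `isCompatible_tvsupp_iff`, `polymerPartitionFunction_tvsupp`, `hardCore_tvsupp`, `rhoT_tvsupp`.

**Reading note (GAPS.md G-C2-p25-03, continued; located at p. 310).** In the honest two-species bookkeeping the factors of p. 310 must read
`u(X,Y) = 0` iff `X, Y` are INCOMPATIBLE (overlap, or both multi-region for their own Mayer data and abutting), not merely overlapping. By this
file that is again an overlap condition — for the virtual supports in the finite set `ι ⊕ (P × P)` — so *"put u = 1 + a and expand"*, the
factorization of the normalization, the connected-graph formula for the truncated functions (gen 6, hypotheses: nonempty polymers, absolute
convergence) and [Dimock2013]'s tree-graph machinery apply to the typed gas WITHOUT CHANGE, with `a(ℒ) = −1` also for two abutting species-B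
clusters. NOT summit progress; NOT continuum; NOT Clay; no convergence is asserted here. Imports: `BIJ88TwoSpeciesPolymerGas` (gen 9) and
`BIJ88RootedUrsell310` (gen 6); modifies nothing. Cell `lit-balaban` Phase 2, seat p25 gen 9; rows C2.Claim@310 / C2.Eq5.13.3-5.13.4 (owner r16,
referee ref-5).
-/

open Finset
open Literature.Probability.LatticeModels (IsCompatible polymerPartitionFunction hcUrsell hcUrsell_congr)
open Literature.MathematicalPhysics.QuantumFieldTheory.Dimock2011to13.UrsellTreeGraphBound (rhoT overlapGraph)
open Literature.MathematicalPhysics.QuantumFieldTheory.BalabanImbrieJaffe1984to88.BIJ88RootedUrsell310 (hardCore)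
open Literature.MathematicalPhysics.QuantumFieldTheory.BalabanImbrieJaffe1984to88.BIJ88TwoSpeciesPolymerGas (tinc tinc_refl tinc_symm)

namespace Literature.MathematicalPhysics.QuantumFieldTheory.BalabanImbrieJaffe1984to88.BIJ88VirtualSupports310

/-! ## §1 Virtual supports -/

section General

variable {V : Type*} [DecidableEq V]

/-- **the overlap incompatibility** *"u(X,Y) = 0 if X, Y overlap"*: two finite sets meet. [cite: BalabanImbrieJaffe1988, p.310 (Sect. 5.14)] -/
def Overlap (Z Z' : Finset V) : Prop := ¬ Disjoint Z Z'

/-- overlap is decidable. [cite: BalabanImbrieJaffe1988, p.310 (Sect. 5.14)] -/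
instance instDecidableRelOverlap : DecidableRel (Overlap (V := V)) := fun Z Z' => inferInstanceAs (Decidable (¬ Disjoint Z Z'))

variable {P C : Type*} [DecidableEq P] [DecidableEq C] (inc : P → P → Prop) [DecidableRel inc] (supp : P → Finset C) (Λ : Finset P)

/-- **the VIRTUAL SUPPORT of a polymer** relative to the family `Λ`: its cubes (tagged `inl`) together with the incompatible pairs through it,
`(p, q)` and `(q, p)` for `q ∈ Λ` incompatible with `p`, and `(p, p)`. Two virtual supports meet iff the polymers are incompatible
(`not_disjoint_vsupp_iff`), so *"u(X,Y) = 0 if X, Y overlap"* for virtual supports is a general pair incompatibility.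
[cite: BalabanImbrieJaffe1988, p.310 (Sect. 5.14)] -/
def vsupp (p : P) : Finset (C ⊕ (P × P)) :=
  (supp p).image Sum.inl ∪ (insert p (Λ.filter fun q => inc p q)).image (fun q => Sum.inr (p, q)) ∪
    (Λ.filter fun q => inc p q).image fun q => Sum.inr (q, p)

variable {inc supp Λ}

/-- **the cube content of a virtual support is the support**: covering conditions (*"Each X_γ must cover and connect all the t-derivatives
specified by H_γ"*, p. 309) are unchanged. [cite: BalabanImbrieJaffe1988, p.309 (Sect. 5.14)] -/
theorem inl_mem_vsupp_iff {p : P} {c : C} : (Sum.inl c : C ⊕ (P × P)) ∈ vsupp inc supp Λ p ↔ c ∈ supp p := by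
  simp [vsupp]

/-- the diagonal pair lies in the virtual support. [cite: BalabanImbrieJaffe1988, p.310 (Sect. 5.14)] -/
theorem inr_self_mem_vsupp (p : P) : (Sum.inr (p, p) : C ⊕ (P × P)) ∈ vsupp inc supp Λ p :=
  mem_union.2 (Or.inl (mem_union.2 (Or.inr (mem_image_of_mem _ (mem_insert_self _ _)))))

/-- an incompatible pair lies in the virtual support of its first member. [cite: BalabanImbrieJaffe1988, p.310 (Sect. 5.14)] -/
theorem inr_mem_vsupp_left {p q : P} (hq : q ∈ Λ) (h : inc p q) : (Sum.inr (p, q) : C ⊕ (P × P)) ∈ vsupp inc supp Λ p :=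
  mem_union.2 (Or.inl (mem_union.2 (Or.inr (mem_image_of_mem _ (mem_insert_of_mem (mem_filter.2 ⟨hq, h⟩))))))

/-- an incompatible pair lies in the virtual support of its second member. [cite: BalabanImbrieJaffe1988, p.310 (Sect. 5.14)] -/
theorem inr_mem_vsupp_right {p q : P} (hq : q ∈ Λ) (h : inc p q) : (Sum.inr (q, p) : C ⊕ (P × P)) ∈ vsupp inc supp Λ p :=
  mem_union.2 (Or.inr (mem_image_of_mem _ (mem_filter.2 ⟨hq, h⟩)))

/-- what a pair in a virtual support looks like. [cite: BalabanImbrieJaffe1988, p.310 (Sect. 5.14)] -/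
theorem of_inr_mem_vsupp {p x y : P} (h : (Sum.inr (x, y) : C ⊕ (P × P)) ∈ vsupp inc supp Λ p) :
    (x = p ∧ (y = p ∨ inc p y)) ∨ (y = p ∧ inc p x) := by
  rcases mem_union.1 h with h | h
  · rcases mem_union.1 h with h | h
    · obtain ⟨c, -, hc⟩ := mem_image.1 h
      exact absurd hc Sum.inl_ne_inr
    · obtain ⟨a, ha, hpa⟩ := mem_image.1 h
      obtain ⟨hpx, hay⟩ := Prod.mk.inj (Sum.inr.inj hpa)
      subst hpx hay
      rcases mem_insert.1 ha with rfl | ha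
      · exact Or.inl ⟨rfl, Or.inl rfl⟩
      · exact Or.inl ⟨rfl, Or.inr (mem_filter.1 ha).2⟩
  · obtain ⟨a, ha, hpa⟩ := mem_image.1 h
    obtain ⟨hax, hpy⟩ := Prod.mk.inj (Sum.inr.inj hpa)
    subst hax hpy
    exact Or.inr ⟨rfl, (mem_filter.1 ha).2⟩

/-- **virtual supports determine the polymer.** [cite: BalabanImbrieJaffe1988, p.310 (Sect. 5.14)] -/
theorem vsupp_injective : Function.Injective (vsupp inc supp Λ) := by
  intro p q h
  have hp := inr_self_mem_vsupp (inc := inc) (supp := supp) (Λ := Λ) p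
  rw [h] at hp
  rcases of_inr_mem_vsupp hp with ⟨hpq, -⟩ | ⟨hpq, -⟩ <;> exact hpq

/-- **TWO VIRTUAL SUPPORTS OVERLAP IFF THE POLYMERS ARE INCOMPATIBLE** (for a reflexive symmetric incompatibility implied by overlapping
supports, and members of the family): *"u(X,Y) = 0 if X, Y overlap"* for virtual supports is `u = 𝟙[compatible]`.
[cite: BalabanImbrieJaffe1988, p.310 (Sect. 5.14)] -/
theorem not_disjoint_vsupp_iff (hrefl : ∀ p, inc p p) (hsymm : ∀ p q, inc p q → inc q p)
    (hsupp : ∀ p q, ¬ Disjoint (supp p) (supp q) → inc p q) {p q : P} (hp : p ∈ Λ) (hq : q ∈ Λ) :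
    ¬ Disjoint (vsupp inc supp Λ p) (vsupp inc supp Λ q) ↔ inc p q := by
  constructor
  · intro h
    obtain ⟨e, hep, heq⟩ := not_disjoint_iff.1 h
    rcases e with c | ⟨x, y⟩
    · exact hsupp p q (not_disjoint_iff.2 ⟨c, inl_mem_vsupp_iff.1 hep, inl_mem_vsupp_iff.1 heq⟩)
    · rcases of_inr_mem_vsupp hep with ⟨hxp, -⟩ | ⟨hyp, hx⟩ <;>
        rcases of_inr_mem_vsupp heq with ⟨hxq, -⟩ | ⟨hyq, hx'⟩
      · exact (hxp.symm.trans hxq) ▸ hrefl p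
      · exact hsymm q p (hxp ▸ hx')
      · exact hxq ▸ hx
      · exact (hyp.symm.trans hyq) ▸ hrefl p
  · intro h
    exact not_disjoint_iff.2 ⟨Sum.inr (p, q), inr_mem_vsupp_left hq h, inr_mem_vsupp_right hp (hsymm p q h)⟩

/-! ## §2 Consequences: compatible families, partition functions, Ursell coefficients -/

/-- **compatible families are the families with pairwise disjoint virtual supports** (a compatible family for `inc` is a *"nonoverlapping"*
family of virtual supports). [cite: BalabanImbrieJaffe1988, p.310 (Sect. 5.14)] -/
theorem isCompatible_image_vsupp_iff (hrefl : ∀ p, inc p p) (hsymm : ∀ p q, inc p q → inc q p)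
    (hsupp : ∀ p q, ¬ Disjoint (supp p) (supp q) → inc p q) {A : Finset P} (hA : A ⊆ Λ) :
    IsCompatible Overlap (A.image (vsupp inc supp Λ)) ↔ IsCompatible inc A := by
  constructor
  · intro h p hp q hq hne hi
    have hv : vsupp inc supp Λ p ≠ vsupp inc supp Λ q := fun e => hne (vsupp_injective e)
    exact h (mem_coe.2 (mem_image_of_mem _ hp)) (mem_coe.2 (mem_image_of_mem _ hq)) hv
      ((not_disjoint_vsupp_iff hrefl hsymm hsupp (hA hp) (hA hq)).2 hi)
  · intro h Z hZ Z' hZ' hne hov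
    obtain ⟨p, hp, rfl⟩ := mem_image.1 (mem_coe.1 hZ)
    obtain ⟨q, hq, rfl⟩ := mem_image.1 (mem_coe.1 hZ')
    have hpq : p ≠ q := fun e => hne (by rw [e])
    exact h (mem_coe.2 hp) (mem_coe.2 hq) hpq ((not_disjoint_vsupp_iff hrefl hsymm hsupp (hA hp) (hA hq)).1 hov)

/-- **the partition function for `inc` IS the overlap-hard-core partition function of the virtual supports** (with the activity carried
over, `ẑ (vsupp p) = z p`): the normalization *"z_t(Λ₁₂)"* of p. 310 for the typed gas is a sum over nonoverlapping families as printed.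
[cite: BalabanImbrieJaffe1988, p.310 (Sect. 5.14)] -/
theorem polymerPartitionFunction_image_vsupp (hrefl : ∀ p, inc p p) (hsymm : ∀ p q, inc p q → inc q p)
    (hsupp : ∀ p q, ¬ Disjoint (supp p) (supp q) → inc p q) (z : P → ℂ) (zv : Finset (C ⊕ (P × P)) → ℂ)
    (hz : ∀ p ∈ Λ, zv (vsupp inc supp Λ p) = z p) :
    polymerPartitionFunction Overlap zv (Λ.image (vsupp inc supp Λ)) = polymerPartitionFunction inc z Λ := by
  rw [polymerPartitionFunction, polymerPartitionFunction, powerset_image,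
    sum_image fun A _ B _ h => image_injective vsupp_injective h]
  refine sum_congr rfl fun A hA => ?_
  have hA' : A ⊆ Λ := mem_powerset.1 hA
  rw [prod_image fun p _ q _ h => vsupp_injective h]
  exact if_congr (isCompatible_image_vsupp_iff hrefl hsymm hsupp hA') (prod_congr rfl fun p hp => hz p (hA' hp)) rfl

/-- **[Dimock2013]'s overlap graph of a tuple of virtual supports is the incompatibility graph of the tuple.**
[cite: BalabanImbrieJaffe1988, p.310 (Sect. 5.14)] -/
theorem overlapGraph_vsupp_iff (hrefl : ∀ p, inc p p) (hsymm : ∀ p q, inc p q → inc q p)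
    (hsupp : ∀ p q, ¬ Disjoint (supp p) (supp q) → inc p q) {κ : Type*} {Z : κ → P} (hZ : ∀ i, Z i ∈ Λ) (i j : κ) :
    overlapGraph (vsupp inc supp Λ ∘ Z) i j ↔ inc (Z i) (Z j) :=
  not_disjoint_vsupp_iff hrefl hsymm hsupp (hZ i) (hZ j)

/-- **the overlap Ursell coefficient `ρ^T` of the virtual supports is the Ursell coefficient of the incompatibility** (the connected-graph
sums *"Σ_{G_c} Π_{ℒ∈G_c} a(ℒ)"* of p. 310 with `a(ℒ) = −1` on incompatible pairs). [cite: BalabanImbrieJaffe1988, p.310 (Sect. 5.14)] -/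
theorem rhoT_vsupp (hrefl : ∀ p, inc p p) (hsymm : ∀ p q, inc p q → inc q p)
    (hsupp : ∀ p q, ¬ Disjoint (supp p) (supp q) → inc p q) {κ : Type*} [DecidableEq κ] {Z : κ → P} (hZ : ∀ i, Z i ∈ Λ)
    (I : Finset κ) : rhoT (vsupp inc supp Λ ∘ Z) I = hcUrsell (fun i j => inc (Z i) (Z j)) I :=
  hcUrsell_congr fun i _ j _ => overlapGraph_vsupp_iff hrefl hsymm hsupp hZ i j

/-- **gen 6's hard core of the virtual supports is the indicator of pairwise compatibility** (*"u(X,Y) … 1 if X, Y do not overlap"* for all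
pairs = all pairs compatible). [cite: BalabanImbrieJaffe1988, p.310 (Sect. 5.14)] -/
theorem hardCore_vsupp (hrefl : ∀ p, inc p p) (hsymm : ∀ p q, inc p q → inc q p)
    (hsupp : ∀ p q, ¬ Disjoint (supp p) (supp q) → inc p q) {κ : Type*} [DecidableEq κ] {Z : κ → P} (hZ : ∀ i, Z i ∈ Λ)
    (I : Finset κ) : hardCore (vsupp inc supp Λ ∘ Z) I = if ∀ i ∈ I, ∀ j ∈ I, i ≠ j → ¬ inc (Z i) (Z j) then 1 else 0 := by
  unfold hardCore
  refine if_congr (forall₂_congr fun i _ => forall₂_congr fun j _ => imp_congr_right fun _ => ?_) rfl rfl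
  show Disjoint (vsupp inc supp Λ (Z i)) (vsupp inc supp Λ (Z j)) ↔ _
  rw [← not_disjoint_vsupp_iff hrefl hsymm hsupp (hZ i) (hZ j), not_not]

end General

/-! ## §3 The typed gas of the honest form of (5.13.4) -/

section Typed

variable {ι : Type*} [DecidableEq ι] (adj : ι → ι → Prop) [DecidableRel adj] (Λ : Finset (Finset ι × Bool))

/-- **the virtual support of a typed polymer** `(X, τ)` of `BIJ88TwoSpeciesPolymerGas`: the cubes of `X` and the `tinc`-incompatible pairs
through it. [cite: BalabanImbrieJaffe1988, (5.13.4) p.306] -/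
abbrev tvsupp : Finset ι × Bool → Finset (ι ⊕ ((Finset ι × Bool) × (Finset ι × Bool))) := vsupp (tinc adj) Prod.fst Λ

variable {adj Λ}

omit [DecidableEq ι] [DecidableRel adj] in
/-- overlapping supports are `tinc`-incompatible. [cite: BalabanImbrieJaffe1988, (5.13.4) p.306] -/
theorem tinc_of_not_disjoint (p q : Finset ι × Bool) (h : ¬ Disjoint p.1 q.1) : tinc adj p q := Or.inr (Or.inl h)

/-- **typed polymers are incompatible iff their virtual supports overlap.** [cite: BalabanImbrieJaffe1988, p.310 (Sect. 5.14)] -/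
theorem not_disjoint_tvsupp_iff {p q : Finset ι × Bool} (hp : p ∈ Λ) (hq : q ∈ Λ) :
    ¬ Disjoint (tvsupp adj Λ p) (tvsupp adj Λ q) ↔ tinc adj p q :=
  not_disjoint_vsupp_iff tinc_refl (fun _ _ => tinc_symm) tinc_of_not_disjoint hp hq

/-- the cubes of a typed virtual support are the cubes of the support. [cite: BalabanImbrieJaffe1988, p.309 (Sect. 5.14)] -/
theorem inl_mem_tvsupp_iff {p : Finset ι × Bool} {c : ι} :
    (Sum.inl c : ι ⊕ ((Finset ι × Bool) × (Finset ι × Bool))) ∈ tvsupp adj Λ p ↔ c ∈ p.1 := inl_mem_vsupp_iff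

/-- **compatible typed families = nonoverlapping families of virtual supports.** [cite: BalabanImbrieJaffe1988, p.310 (Sect. 5.14)] -/
theorem isCompatible_tvsupp_iff {A : Finset (Finset ι × Bool)} (hA : A ⊆ Λ) :
    IsCompatible Overlap (A.image (tvsupp adj Λ)) ↔ IsCompatible (tinc adj) A :=
  isCompatible_image_vsupp_iff tinc_refl (fun _ _ => tinc_symm) tinc_of_not_disjoint hA

/-- **the typed partition function (`BIJ88Eq5134PolymerGas.twoSpecies_eq_polymerPartitionFunction`) is an overlap-hard-core partition
function** — the printed setting of p. 310. [cite: BalabanImbrieJaffe1988, p.310 (Sect. 5.14)] -/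
theorem polymerPartitionFunction_tvsupp (z : Finset ι × Bool → ℂ) (zv : Finset (ι ⊕ ((Finset ι × Bool) × (Finset ι × Bool))) → ℂ)
    (hz : ∀ p ∈ Λ, zv (tvsupp adj Λ p) = z p) :
    polymerPartitionFunction Overlap zv (Λ.image (tvsupp adj Λ)) = polymerPartitionFunction (tinc adj) z Λ :=
  polymerPartitionFunction_image_vsupp tinc_refl (fun _ _ => tinc_symm) tinc_of_not_disjoint z zv hz

/-- **gen 6's hard core (`BIJ88RootedUrsell310.hardCore`) of a tuple of typed virtual supports is `𝟙[pairwise tinc-compatible]`.**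
[cite: BalabanImbrieJaffe1988, p.310 (Sect. 5.14)] -/
theorem hardCore_tvsupp {κ : Type*} [DecidableEq κ] {Z : κ → Finset ι × Bool} (hZ : ∀ i, Z i ∈ Λ) (I : Finset κ) :
    hardCore (tvsupp adj Λ ∘ Z) I = if ∀ i ∈ I, ∀ j ∈ I, i ≠ j → ¬ tinc adj (Z i) (Z j) then 1 else 0 :=
  hardCore_vsupp tinc_refl (fun _ _ => tinc_symm) tinc_of_not_disjoint hZ I

/-- **[Dimock2013]'s `ρ^T` of a tuple of typed virtual supports is the `tinc`-Ursell coefficient** (the connected-graph coefficient of the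
third display of p. 310 for the typed gas). [cite: BalabanImbrieJaffe1988, p.310 (Sect. 5.14)] -/
theorem rhoT_tvsupp {κ : Type*} [DecidableEq κ] {Z : κ → Finset ι × Bool} (hZ : ∀ i, Z i ∈ Λ) (I : Finset κ) :
    rhoT (tvsupp adj Λ ∘ Z) I = hcUrsell (fun i j => tinc adj (Z i) (Z j)) I :=
  rhoT_vsupp tinc_refl (fun _ _ => tinc_symm) tinc_of_not_disjoint hZ I

end Typed

end Literature.MathematicalPhysics.QuantumFieldTheory.BalabanImbrieJaffe1984to88.BIJ88VirtualSupports310
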